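import Summits.QuantumFields.YangMills.Theorems.BalabanUVNodesN13NormalisationSlopeThresholdAtRecord13SepCoPHV
import Summits.QuantumFields.YangMills.Theorems.BalabanUVNodesK2R9Holds

/-!
# BalabanUVNodes ∕ N13 — K1⁹'s WITNESS HAS NORMALISATION SLOPE AT LEAST ≈ d(𝔤)∕4: the body of `StabilityBRunRowsAtRecordR13SepCoPHV` (stmt-QuantumFields-27364) is FALSE at every tuple whose
# numerics slots have log-slope `a` with `2(1−L⁻⁴)(d(𝔤) − a) − (3∕2)d(𝔤) > 0` — K2⁹ by name supplies END from the rows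

(Track A, DAG node N13 = [B16]; cluster K1 — helper for K1⁹ stmt-QuantumFields-27364; seat `pub-ymgap-dag-n13-w3` g5; 2026-08-28; count-neutral; theses cone: imports `…Theorems.BalabanUVNodesK2R9Holds`.)
Cone-side reading of `…N13NormalisationSlopeThresholdAtRecord13SepCoPHV.false_of_endStatementBPrinted_of_endpointExistence_of_logSlope` (the sharp edition of p637054's
`k1R9Body_false_of_couplingBlind`): K1⁹'s body at `(θ, h, v)` — route text after `∃ θ h v,` VERBATIM — gives (B) at the revised datum and, through K2⁹ `endpointGivenRunRowsR13SepCoPHV_holds`, END;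
the slope threshold then fires.  READING FOR THE WITNESS LANES: whatever tuple closes K1⁹, its per-step numerics slots grow at least like `a·log(1∕g_j)·|T^{(j)*}|` with
`a ≥ d(𝔤)(1−4L⁻⁴)∕(4(1−L⁻⁴))` — print's `z` of [I] (0.15) (`log z_j ≈ d(𝔤) log g_j`, slope `d(𝔤)∕4`; tree `B16ZLower`) is the shape the ∃θ needs.
HONEST FRAMING: count-neutral; K1⁹ NEITHER proved NOR refuted (its `∃ θ` ranges over all slots); nothing of Bałaban's asserted or refuted; no skeleton ∕ route text changed; N13 NOT discharged;
counts UNMOVED (typed 28∕28 · discharged 5∕27 · A 5∕28); R4 closes the conditional finite-𝕋⁴ rung `BalabanLadder.UV` only — the Yang–Mills mass gap (Clay) is NOT proved by any of this;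
nothing continuum ∕ ℝ⁴ ∕ OS.  No `sorry`, `def`, `instance`, `notation`.
-/

noncomputable section

open scoped BigOperators

namespace Summit.QuantumFields.YangMills.BalabanUVNodes.N13K1R9WitnessSlopeThreshold

open Literature.MathematicalPhysics.QuantumFieldTheory.Balaban1983to89
open Literature.MathematicalPhysics.QuantumFieldTheory.Balaban1983to89.T4Continuum
open Literature.MathematicalPhysics.QuantumFieldTheory.Balaban1983to89.Node00
open Summit.QuantumFields.YangMills.Theorems.BalabanUVNodesK2R9Holds (endpointGivenRunRowsR13SepCoPHV_holds)
open Summit.QuantumFields.YangMills.BalabanUVNodes.N13NormalisationSlopeThresholdAtRecord13SepCoPHV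
  (false_of_endStatementBPrinted_of_endpointExistence_of_logSlope)

variable {F : T4Family}

/-- **★★★ K1⁹'s BODY IS FALSE AT EVERY TUPLE WITH SUB-THRESHOLD NORMALISATION SLOPE.**  `0 ≤ a ≤ d(𝔤)`, `0 ≤ C_w`, `κ = 2(1−L⁻⁴)(d(𝔤)−a) − (3∕2)d(𝔤) > 0`, slots with
`−logz_p(j)·(L⁴−1)|T₁^{(j+1)}| + Efl_p(j) ≤ (a·(−log g_j) + C_w)·|T^{(j)*}|` (`g_j = gOfRecord₁₃ θ p j`): the text after `∃ θ h v,` of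
`Summit.QuantumFields.YangMills.Theses.BalabanUVNodes.StabilityBRunRowsAtRecordR13SepCoPHV`, VERBATIM, implies `False`.
[cite: Balaban1988Convergent, Thm 1 p.262, (1.15) p.249, Cor. 3 (2.50) p.264; Balaban1987RG1, Thm 2 p.259, (0.15) p.254] -/
theorem k1R9Body_false_of_logSlope (θ : Stage13HParams F 2) (h : θ.Provisos₁₃SepCoPH F 2) (v : Revision₁₃ F 2 θ h) {a Cw : ℝ}
    (ha0 : 0 ≤ a) (ha : a ≤ ((dimSU 2 : ℕ) : ℝ)) (hCw : 0 ≤ Cw)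
    (hκ : 0 < 2 * (1 - ((F.L : ℝ) ^ 4)⁻¹) * (((dimSU 2 : ℕ) : ℝ) - a) - 3 / 2 * ((dimSU 2 : ℕ) : ℝ))
    (hw : ∀ (p : B12.RunParams) (j : ℕ), j < p.K → 0 < gOfRecord₁₃ F 2 θ.toStage13Params p j → gOfRecord₁₃ F 2 θ.toStage13Params p j ≤ 1 →
      -(θ.logz p j) * ((((F.P p.K).L : ℝ) ^ 4 - 1) * sitesCard (F.P p.K) (j + 1)) + θ.Efl p j ≤
        (a * (-Real.log (gOfRecord₁₃ F 2 θ.toStage13Params p j)) + Cw) * tstarCount (F.P p.K) j)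
    (hbody : (θ.ZhUnity F 2 ∧ θ.SlotsNondegenerate₁₃ F 2) ∧ θ.Admissible F 2 ∧ B16.EndStatementBPrinted (Node00.datumOfRecord₁₃SepCoPHV F 2 θ h v).C ∧ (∃ γ₁ : ℝ, 0 < γ₁ ∧ ∀ γ : ℝ, 0 < γ → γ ≤ γ₁ → ∃ P : B12.RunParams, 1 ≤ P.K ∧ ((Node00.datumOfRecord₁₃SepCoPHV F 2 θ h v).C P).flow.InInterval γ P.K) ∧ ∃ (b : ℕ → ℝ) (r γ₀ M : ℝ), 0 < γ₀ ∧ (∀ (n : ℕ) (gs : ℕ → ℝ), FlowStep.RGEqH n (Node00.betaOfRecord₁₃ F 2 θ.toStage13Params) gs → Step.InInterval γ₀ n gs → ∀ k, k ≤ n → |Node00.betaOfRecord₁₃ F 2 θ.toStage13Params k (FlowStep.prefixOf gs k) - b k| ≤ r) ∧ (∀ (n : ℕ) (gs : ℕ → ℝ), FlowStep.RGEqH n (Node00.betaOfRecord₁₃ F 2 θ.toStage13Params) gs → Step.InInterval γ₀ n gs → ∀ k, k ≤ n → -M ≤ ∑ j ∈ Finset.Ico k n, Node00.betaOfRecord₁₃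 F 2 θ.toStage13Params j (FlowStep.prefixOf gs j)) ∧ ∀ k : ℕ, ContinuousOn (fun x : ℝ => Node00.betaOfRecord₁₃ F 2 θ.toStage13Params k (FlowStep.clampPrefix (Node00.betaOfRecord₁₃ F 2 θ.toStage13Params) γ₀ k x)) {x : ℝ | 0 < x ∧ x ≤ γ₀ ∧ ∀ j, j ≤ k → 1 / γ₀ ^ 2 ≤ FlowStep.Y (Node00.betaOfRecord₁₃ F 2 θ.toStage13Params) γ₀ j x}) : False := by
  obtain ⟨hU, hθ, hB, hwin, hrows⟩ := hbody
  exact false_of_endStatementBPrinted_of_endpointExistence_of_logSlope θ h v ha0 ha hCw hκ hw hB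
    (endpointGivenRunRowsR13SepCoPHV_holds F θ h v hU hθ hB hrows hwin)

/-- **READING FOR THE SUPPLIER LANES (`SU(2)`, `d(𝔤) = 3`)**: if K1⁹ holds then at every family with the K0⁷ antecedent its witness's slots VIOLATE the slope-`a` bound for EVERY
`a ∈ [0, 3]` with `2(1−L⁻⁴)(3 − a) > 9∕2` and every `C_w ≥ 0` — some run and step IN THE WEAK-COUPLING REGIME `0 < g_j ≤ 1` has `−logz_p(j)·(L⁴−1)|T₁^{(j+1)}| + Efl_p(j) > (a·log(1∕g_j) + C_w)·|T^{(j)*}|`.  CONDITIONAL on the crux.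
[cite: Balaban1988Convergent, Thm 1 p.262, (1.15) p.249; Balaban1987RG1, (0.15) p.254] -/
theorem k1R9Witness_slope_exceeds (hK1 : Summit.QuantumFields.YangMills.Theses.BalabanUVNodes.StabilityBRunRowsAtRecordR13SepCoPHV) (F : T4Family)
    (h0 : ∃ θ : Stage13HParams F 2, θ.Provisos₁₃SepCoPH F 2 ∧ (θ.ZhUnity F 2 ∧ θ.SlotsNondegenerate₁₃ F 2) ∧ θ.Admissible F 2)
    {a Cw : ℝ} (ha0 : 0 ≤ a) (ha : a ≤ ((dimSU 2 : ℕ) : ℝ)) (hCw : 0 ≤ Cw)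
    (hκ : 0 < 2 * (1 - ((F.L : ℝ) ^ 4)⁻¹) * (((dimSU 2 : ℕ) : ℝ) - a) - 3 / 2 * ((dimSU 2 : ℕ) : ℝ)) :
    ∃ (θ : Stage13HParams F 2) (h : θ.Provisos₁₃SepCoPH F 2) (v : Revision₁₃ F 2 θ h),
      B16.EndStatementBPrinted (datumOfRecord₁₃SepCoPHV F 2 θ h v).C ∧
      ∃ (p : B12.RunParams) (j : ℕ), j < p.K ∧ 0 < gOfRecord₁₃ F 2 θ.toStage13Params p j ∧ gOfRecord₁₃ F 2 θ.toStage13Params p j ≤ 1 ∧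
        (a * (-Real.log (gOfRecord₁₃ F 2 θ.toStage13Params p j)) + Cw) * tstarCount (F.P p.K) j <
          -(θ.logz p j) * ((((F.P p.K).L : ℝ) ^ 4 - 1) * sitesCard (F.P p.K) (j + 1)) + θ.Efl p j := by
  obtain ⟨θ, h, v, hbody⟩ := hK1 F h0
  refine ⟨θ, h, v, hbody.2.2.1, ?_⟩
  by_contra hno
  push Not at hno
  exact k1R9Body_false_of_logSlope θ h v ha0 ha hCw hκ (fun p j hj h0' h1 => hno p j hj h0' h1) hbody

end Summit.QuantumFields.YangMills.BalabanUVNodes.N13K1R9WitnessSlopeThreshold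

end
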